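import Mathlib

/-!
# Reduced-round linearity (pre-birth game of the forced-multisection customer Q47₂, memo §14.7 / idea-3 g16 LEMMA A)

Kernel twin of the one algebraic identity behind the «cancelling chain» step of LEMMA Q∞ for Q47₂
(`FORCED-MULTISECTION-Q47.md` §14.7, idea-3 `MEMO-idea3-g16.md` §2): if the equation of the strict transform restricted
to the exceptional surface is `f = (a − φ)·h` with the centre `{a = φ}` a SIMPLE component, i.e. the full equation is
`T = (a − φ)·h + v·T₁`, then after the round `a = v·a′ + φ` the total transform is `v·Q` with
`Q ≡ a′·h + T₁(φ)  (mod v)` — LINEAR in the new coordinate `a′`.  Here the coefficient ring `B` stands for the functions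
of the other coordinates `(b, v)` (so `v φ h : B`), and `a` is the polynomial variable `X`.
[OURS · L1 W4.5b · kill side · helper identity, no geometry claimed in type; AI-written]
-/

set_option linter.dupNamespace false -- mandated namespace `Summit.<Summit>.<Problem>` of this single-conjunct summit

namespace Summit.ResolutionOfSingularities.ResolutionOfSingularities.Cruxes.EquisingularLiftNat.Sections.ReducedRound

open Polynomial

variable {B : Type*} [CommRing B]

/-- The substitution `a ↦ v·a′ + φ` applied to `T = (X − C φ)·C h + C v·T₁` is `C v` times
`Q := X·C h + T₁.comp (C v·X + C φ)`. [OURS] -/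
theorem comp_round_eq (v φ h : B) (T₁ : B[X]) :
    ((X - C φ) * C h + C v * T₁).comp (C v * X + C φ) = C v * (X * C h + T₁.comp (C v * X + C φ)) := by
  simp only [add_comp, mul_comp, sub_comp, X_comp, C_comp]
  ring

/-- `C v` divides `p.comp (C v·X + C φ) − C (p.eval φ)`: composing with the round and reducing mod `v` evaluates at `φ`.
[OURS] -/
theorem C_dvd_comp_round_sub_C_eval (v φ : B) (p : B[X]) :
    C v ∣ p.comp (C v * X + C φ) - C (p.eval φ) := by
  have h1 : p.comp (C v * X + C φ) - C (p.eval φ) = p.comp (C v * X + C φ) - p.comp (C φ) := by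
    rw [comp_C]
  have h2 : (C v * X + C φ) - C φ ∣ p.comp (C v * X + C φ) - p.comp (C φ) := by
    have := Polynomial.sub_dvd_eval_sub (C v * X + C φ) (C φ) (p.map C)
    simpa only [eval_map, Polynomial.comp] using this
  rw [h1]
  refine dvd_trans ?_ h2
  exact ⟨X, by ring⟩

/-- **Reduced-round linearity.** With `T := (X − C φ)·C h + C v·T₁` (the centre `X = φ` is a simple component of `T mod v`),
the transform `T.comp (C v·X + C φ)` equals `C v·Q` for a `Q` with `Q ≡ X·C h + C (T₁.eval φ) (mod C v)` — the new
exceptional trace is LINEAR in the new coordinate.  (memo §14.7; idea-3 g16 LEMMA A) [OURS] -/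
theorem reduced_round_linear (v φ h : B) (T₁ : B[X]) :
    ∃ Q : B[X], ((X - C φ) * C h + C v * T₁).comp (C v * X + C φ) = C v * Q ∧
      C v ∣ Q - (X * C h + C (T₁.eval φ)) := by
  refine ⟨X * C h + T₁.comp (C v * X + C φ), comp_round_eq v φ h T₁, ?_⟩
  have : X * C h + T₁.comp (C v * X + C φ) - (X * C h + C (T₁.eval φ)) =
      T₁.comp (C v * X + C φ) - C (T₁.eval φ) := by ring
  rw [this]
  exact C_dvd_comp_round_sub_C_eval v φ T₁

end Summit.ResolutionOfSingularities.ResolutionOfSingularities.Cruxes.EquisingularLiftNat.Sections.ReducedRound
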